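import Summits.NavierStokesRegularity.NavierStokesRegularity.Theorems.TerminalTraceTypeITraceScarL3ExtinctApexUnit
import Summits.NavierStokesRegularity.NavierStokesRegularity.Theorems.TerminalTraceTypeITraceScarL3ApexZoomLimitTools
import Literature.Analysis.FluidPDE.LocalPlainPressureBound
import HarnessLib

/-!
# The ZOOM LIMIT of an extinct Type-I apex at its (singular) origin is again an extinct Type-I apex — non-trivial,
# with the zooms converging in `L³(Q(a))` (tool for stubs Z4/Z5 of the line `radius_dichotomy`, item
# `TerminalTrace.TypeITraceScarL3`, stmt-NavierStokesRegularity-18385)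

Seat nsreg-C26-p1 g5 (cell ns-regularity-ideate), `--supports stmt-NavierStokesRegularity-18385` (helper).

`exists_apexZoomLimit`: let `(U, P, G)` carry the extinct Type-I apex package of class `(M, D₀, C)` at the origin
(suitable in every `Q(a)`, weak gradient, `𝐈(Q(a)) ≤ M`, plain `D ≤ D₀` at every apex `≤ 0`, rate `C/√(−s)` a.e. on
every slice, weakly null top) with a backward-SINGULAR origin. Then there are scales `λ_j → 0⁺` and a triple
`(V, Q, H)` of SOME class `(M', D₀', C')` — all six clauses, INCLUDING the weak top-vanishing — such that the zooms
`λ_j U(λ_j²·, λ_j·)` converge to `V` in `L³(Q(a))` for every `a > 0` and `V` is not a.e. zero on `Q(1)`.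

Proof = the tree's first-zoom pipeline `extinctApex_of_L3trace_unit` (steps (5)–(9), (14)) run on the class member
itself: Seregin's extraction `Seregin2020.exists_ancientLimit` (compactness + persistence + the cubic floor `κ`), the slab
class `slab_typeIBound_of_zoomLimit` (`𝐈 ≤ 4M`), the rate through the zooms a.e. (`ae_le_of_tendsto_eLpNorm_three`) and a
pointwise representative (`exists_rate_profile_repr`), the plain pressure bound `blowup_cknD_le_apex_of_tendsto`, and the NEW
input: the top-vanishing of the limit by the uniform pairing modulus (`weakNull_of_zoomLimit`).
WHAT THIS IS NOT: 18385 / NS regularity NOT proved. [folklore; AlbrittonBarker2019 §3; Seregin2014 §6.6; ESS2003 §3]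
-/

noncomputable section

set_option linter.dupNamespace false

namespace Summit.NavierStokesRegularity.NavierStokesRegularity.Theorems.TypeITraceScarL3

open MeasureTheory Set Function Filter Topology TopologicalSpace Metric InnerProductSpace
open Literature.Analysis.FluidPDE Literature.Analysis.FluidPDE.SereginSverak2009
open scoped NNReal ENNReal RealInnerProductSpace

/-- **Slice-wise rate ⇒ product-a.e. rate on a parabolic ball.** If `uncurry V` is a.e. strongly measurable on
`Q_a(0)` and `‖V(s, ·)‖ ≤ C/√(−s)` a.e. for every `s < 0`, then `‖V z‖ ≤ C/√(−z.1)` for a.e. `z ∈ Q_a(0)` (Fubini through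
a strongly measurable representative). [folklore] -/
theorem ae_cylinder_rate_of_slices
    {V : ℝ → EuclideanSpace ℝ (Fin 3) → EuclideanSpace ℝ (Fin 3)} {a C : ℝ}
    (hV : AEStronglyMeasurable (uncurry V)
      (volume.restrict (parabolicCylinder a (0 : ℝ × EuclideanSpace ℝ (Fin 3)))))
    (hrate : ∀ s : ℝ, s < 0 → ∀ᵐ y : EuclideanSpace ℝ (Fin 3), ‖V s y‖ ≤ C / Real.sqrt (-s)) :
    ∀ᵐ z ∂(volume.restrict (parabolicCylinder a (0 : ℝ × EuclideanSpace ℝ (Fin 3)))),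
      ‖V z.1 z.2‖ ≤ C / Real.sqrt (-z.1) := by
  have hQ : parabolicCylinder a (0 : ℝ × EuclideanSpace ℝ (Fin 3)) =
      Ioo (-a ^ 2) (0 : ℝ) ×ˢ ball (0 : EuclideanSpace ℝ (Fin 3)) a := by
    rw [parabolicCylinder]; simp
  rw [hQ] at hV ⊢
  obtain ⟨W, hWm, hVW⟩ := hV
  have hprod : (volume.restrict (Ioo (-a ^ 2) (0 : ℝ) ×ˢ ball (0 : EuclideanSpace ℝ (Fin 3)) a)) =
      ((volume : Measure ℝ).restrict (Ioo (-a ^ 2) 0)).prod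
        ((volume : Measure (EuclideanSpace ℝ (Fin 3))).restrict (ball 0 a)) := by
    rw [Measure.prod_restrict, ← Measure.volume_eq_prod]
  have hE : MeasurableSet {z : ℝ × EuclideanSpace ℝ (Fin 3) | ‖W z‖ ≤ C / Real.sqrt (-z.1)} :=
    measurableSet_le hWm.norm.measurable ((measurable_const.div (measurable_fst.neg.sqrt)))
  have h1 : ∀ᵐ s ∂((volume : Measure ℝ).restrict (Ioo (-a ^ 2) 0)),
      ∀ᵐ y ∂((volume : Measure (EuclideanSpace ℝ (Fin 3))).restrict (ball 0 a)),
        uncurry V (s, y) = W (s, y) := by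
    have := hVW
    rw [hprod] at this
    exact Measure.ae_ae_of_ae_prod this
  have h2 : ∀ᵐ s ∂((volume : Measure ℝ).restrict (Ioo (-a ^ 2) 0)),
      ∀ᵐ y ∂((volume : Measure (EuclideanSpace ℝ (Fin 3))).restrict (ball 0 a)),
        (s, y) ∈ {z : ℝ × EuclideanSpace ℝ (Fin 3) | ‖W z‖ ≤ C / Real.sqrt (-z.1)} := by
    filter_upwards [h1, ae_restrict_mem measurableSet_Ioo] with s hs hsI
    filter_upwards [hs, ae_restrict_of_ae (hrate s hsI.2)] with y hy hy'
    show ‖W (s, y)‖ ≤ C / Real.sqrt (-s)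
    rw [← hy]
    exact hy'
  have h4 : ∀ᵐ z ∂(volume.restrict (Ioo (-a ^ 2) (0 : ℝ) ×ˢ ball (0 : EuclideanSpace ℝ (Fin 3)) a)),
      z ∈ {z : ℝ × EuclideanSpace ℝ (Fin 3) | ‖W z‖ ≤ C / Real.sqrt (-z.1)} := by
    rw [hprod]
    exact (Measure.ae_prod_mem_iff_ae_ae_mem hE).2 h2
  filter_upwards [h4, hVW] with z hz hzW
  have : ‖uncurry V z‖ ≤ C / Real.sqrt (-z.1) := by rw [hzW]; exact hz
  exact this

set_option maxHeartbeats 3200000 in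
/-- **The zoom limit of an extinct Type-I apex at a singular origin** (module docstring): scales `λ_j → 0⁺`, a class
`(M', D₀', C')` and a triple `(V, Q, H)` with all six clauses of the extinct apex package, the `L³(Q(a))` convergence of the
zooms `λ_j • U(λ_j²·, λ_j·) → V` for every `a > 0`, and `V` not a.e. zero on `Q(1)`.
[cite: AlbrittonBarker2019, §3; Seregin2014, §6.6 Prop. 6.20; EscauriazaSereginSverak2003, §3 (3.13)] -/
theorem exists_apexZoomLimit
    {U : ℝ → EuclideanSpace ℝ (Fin 3) → EuclideanSpace ℝ (Fin 3)}
    {P : ℝ → EuclideanSpace ℝ (Fin 3) → ℝ}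
    {G : ℝ → EuclideanSpace ℝ (Fin 3) → EuclideanSpace ℝ (Fin 3) →L[ℝ] EuclideanSpace ℝ (Fin 3)}
    {M D₀ : ℝ≥0} {C : ℝ}
    (hsw : ∀ a : ℝ, 0 < a →
      IsSuitableWeakSolutionInBall a (0 : ℝ × EuclideanSpace ℝ (Fin 3)) U P)
    (hG : ∀ a : ℝ, 0 < a →
      HasWeakSpatialGradientOn
        (parabolicCylinderOpens a (0 : ℝ × EuclideanSpace ℝ (Fin 3))) U G)
    (hI : ∀ a : ℝ, 0 < a →
      typeIBound (parabolicCylinder a (0 : ℝ × EuclideanSpace ℝ (Fin 3))) U P G ≤ M)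
    (hD : ∀ z₀ : ℝ × EuclideanSpace ℝ (Fin 3), z₀.1 ≤ 0 →
      ∀ r : ℝ, 0 < r → cknD r z₀ P ≤ D₀)
    (hrate : ∀ s : ℝ, s < 0 →
      ∀ᵐ y : EuclideanSpace ℝ (Fin 3), ‖U s y‖ ≤ C / Real.sqrt (-s))
    (htop : ∀ φ : EuclideanSpace ℝ (Fin 3) → EuclideanSpace ℝ (Fin 3),
      ContDiff ℝ (⊤ : ℕ∞) φ →
      HasCompactSupport φ → ∀ ε : ℝ, 0 < ε →
      ∃ s₀ : ℝ, s₀ < 0 ∧ ∀ᵐ s ∂(volume.restrict (Ioo s₀ 0)), |∫ y, ⟪U s y, φ y⟫| ≤ ε)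
    (hsing : IsBackwardSingularPoint U (0 : ℝ × EuclideanSpace ℝ (Fin 3))) (hC : 0 ≤ C) :
    ∃ (lam : ℕ → ℝ) (M' D₀' : ℝ≥0) (C' : ℝ)
      (V : ℝ → EuclideanSpace ℝ (Fin 3) → EuclideanSpace ℝ (Fin 3))
      (Q : ℝ → EuclideanSpace ℝ (Fin 3) → ℝ)
      (H : ℝ → EuclideanSpace ℝ (Fin 3) → EuclideanSpace ℝ (Fin 3) →L[ℝ] EuclideanSpace ℝ (Fin 3)),
      (∀ j, 0 < lam j) ∧ Tendsto lam atTop (𝓝 0) ∧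
      (∀ a : ℝ, 0 < a →
        IsSuitableWeakSolutionInBall a (0 : ℝ × EuclideanSpace ℝ (Fin 3)) V Q) ∧
      (∀ a : ℝ, 0 < a →
        HasWeakSpatialGradientOn
          (parabolicCylinderOpens a (0 : ℝ × EuclideanSpace ℝ (Fin 3))) V H) ∧
      (∀ a : ℝ, 0 < a →
        typeIBound (parabolicCylinder a (0 : ℝ × EuclideanSpace ℝ (Fin 3))) V Q H ≤ M') ∧
      (∀ z₀ : ℝ × EuclideanSpace ℝ (Fin 3), z₀.1 ≤ 0 →
        ∀ r : ℝ, 0 < r → cknD r z₀ Q ≤ D₀') ∧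
      (∀ s : ℝ, s < 0 →
        ∀ᵐ y : EuclideanSpace ℝ (Fin 3), ‖V s y‖ ≤ C' / Real.sqrt (-s)) ∧
      (∀ φ : EuclideanSpace ℝ (Fin 3) → EuclideanSpace ℝ (Fin 3),
        ContDiff ℝ (⊤ : ℕ∞) φ →
        HasCompactSupport φ → ∀ ε : ℝ, 0 < ε →
        ∃ s₀ : ℝ, s₀ < 0 ∧ ∀ᵐ s ∂(volume.restrict (Ioo s₀ 0)), |∫ y, ⟪V s y, φ y⟫| ≤ ε) ∧
      (∀ a : ℝ, 0 < a →
        MemLp (uncurry V) 3 (volume.restrict (parabolicCylinder a (0 : ℝ × EuclideanSpace ℝ (Fin 3)))) ∧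
        Tendsto (fun j => eLpNorm
            (uncurry ((lam j) • stPull ((lam j) ^ 2) (lam j) (0 : ℝ)
              (0 : EuclideanSpace ℝ (Fin 3)) U) - uncurry V) 3
            (volume.restrict (parabolicCylinder a (0 : ℝ × EuclideanSpace ℝ (Fin 3)))))
          atTop (𝓝 0)) ∧
      ¬ (∀ᵐ z ∂(volume.restrict (parabolicCylinder 1 (0 : ℝ × EuclideanSpace ℝ (Fin 3)))), V z.1 z.2 = 0) := by
  have hsqrt2 : Real.sqrt 2 ≤ 2 := by
    rw [Real.sqrt_le_left (by norm_num)]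
    norm_num
  have hball' : IsSuitableWeakSolutionInBall 2 0 U P := hsw 2 (by norm_num)
  have hG' : HasWeakSpatialGradientOn (parabolicCylinderOpens 2 (0 : ℝ × EuclideanSpace ℝ (Fin 3))) U G :=
    hG 2 (by norm_num)
  have hI' : typeIBound (parabolicCylinder 1 (0 : ℝ × EuclideanSpace ℝ (Fin 3))) U P G < ⊤ :=
    lt_of_le_of_lt (hI 1 one_pos) ENNReal.coe_lt_top
  -- ## (5) the inputs of the zoom-in extraction on `𝒞 × (−1, 0) ⊆ Q(0, 2)`
  have hPQ : parCyl (0 : ℝ × EuclideanSpace ℝ (Fin 3)) 1 ⊆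
      parabolicCylinder 2 (0 : ℝ × EuclideanSpace ℝ (Fin 3)) := by
    intro z hz
    obtain ⟨ht, hx⟩ := hz
    have hx' := spaceCyl_subset_ball (0 : EuclideanSpace ℝ (Fin 3)) zero_le_one hx
    rw [mul_one, mem_ball_zero_iff] at hx'
    simp only [Prod.fst_zero, one_pow, zero_sub, mem_Ioo] at ht
    rw [SuitableCompactness.mem_parabolicCylinder_zero]
    exact ⟨⟨by linarith [ht.1], ht.2⟩, lt_of_lt_of_le hx' hsqrt2⟩
  have hle : parCylOpens (0 : ℝ × EuclideanSpace ℝ (Fin 3)) 1 ≤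
      parabolicCylinderOpens 2 (0 : ℝ × EuclideanSpace ℝ (Fin 3)) := fun z hz => hPQ hz
  have hsw3 : IsSuitableWeakSolutionOn (parCylOpens (0 : ℝ × EuclideanSpace ℝ (Fin 3)) 1) 1 0 U P :=
    IsSuitableWeakSolutionOn.mono_holds hball'.1 hle
  have hA3 : ∃ Cc : ℝ≥0, ∀ᵐ t ∂(volume.restrict (Ioo (-1 : ℝ) 0)),
      ∫⁻ x in spaceCyl (0 : EuclideanSpace ℝ (Fin 3)) 1, ‖U t x‖ₑ ^ 2 ≤ Cc := by
    obtain ⟨Cc, hCc⟩ := hball'.2.1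
    refine ⟨Cc, ?_⟩
    have hsub : Ioo (-1 : ℝ) 0 ⊆ Ioo ((0 : ℝ × EuclideanSpace ℝ (Fin 3)).1 - 2 ^ 2)
        (0 : ℝ × EuclideanSpace ℝ (Fin 3)).1 := by
      intro t ht
      simp only [Prod.fst_zero, zero_sub, mem_Ioo]
      exact ⟨by linarith [ht.1], ht.2⟩
    have hballsub : spaceCyl (0 : EuclideanSpace ℝ (Fin 3)) 1 ⊆
        ball (0 : ℝ × EuclideanSpace ℝ (Fin 3)).2 2 := by
      refine (spaceCyl_subset_ball (0 : EuclideanSpace ℝ (Fin 3)) zero_le_one).trans ?_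
      rw [mul_one, Prod.snd_zero]
      exact ball_subset_ball hsqrt2
    filter_upwards [ae_restrict_of_ae_restrict_of_subset hsub hCc] with t ht
    exact (lintegral_mono_set hballsub).trans ht
  have hG3 : HasWeakSpatialGradientOn (parCylOpens (0 : ℝ × EuclideanSpace ℝ (Fin 3)) 1) U G :=
    hG'.mono hle
  have hE3 : ∫⁻ z in parCyl (0 : ℝ × EuclideanSpace ℝ (Fin 3)) 1,
      ENNReal.ofReal (frobeniusNormSq (G z.1 z.2)) < ⊤ := by
    obtain ⟨G'', hG'', hG''2⟩ := hball'.2.2.1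
    have hae := hG'.ae_eq hG''
    rw [coe_parabolicCylinderOpens] at hae
    refine lt_of_le_of_lt (lintegral_mono_set hPQ) ?_
    have e : ∫⁻ z in parabolicCylinder 2 (0 : ℝ × EuclideanSpace ℝ (Fin 3)),
        ENNReal.ofReal (frobeniusNormSq (G z.1 z.2)) =
        ∫⁻ z in parabolicCylinder 2 (0 : ℝ × EuclideanSpace ℝ (Fin 3)),
        ENNReal.ofReal (frobeniusNormSq (G'' z.1 z.2)) := by
      refine lintegral_congr_ae ?_
      filter_upwards [hae] with z hz
      have hz' : G z.1 z.2 = G'' z.1 z.2 := hz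
      rw [hz']
    rw [e]
    exact hG''2
  have hp3 : ∫⁻ z in parCyl (0 : ℝ × EuclideanSpace ℝ (Fin 3)) 1,
      ‖P z.1 z.2‖ₑ ^ (3 / 2 : ℝ) < ⊤ := by
    obtain ⟨h32, h32', h32r⟩ := threeHalves_facts
    have hm : MemLp (uncurry P) (3 / 2)
        (volume.restrict (parabolicCylinder 2 (0 : ℝ × EuclideanSpace ℝ (Fin 3)))) := hball'.2.2.2
    have h2 := hm.2
    rw [eLpNorm_eq_lintegral_rpow_enorm_toReal (by norm_num) h32', h32r] at h2
    have hfin : ∫⁻ z in parabolicCylinder 2 (0 : ℝ × EuclideanSpace ℝ (Fin 3)),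
        ‖uncurry P z‖ₑ ^ (3 / 2 : ℝ) < ⊤ := by
      by_contra htop'
      rw [not_lt, top_le_iff] at htop'
      rw [htop', ENNReal.top_rpow_of_pos (by norm_num)] at h2
      exact lt_irrefl _ h2
    exact lt_of_le_of_lt (lintegral_mono_set hPQ) hfin
  have hI3 : Seregin2020.blowupIndex 0 U G < ⊤ := by
    refine lt_of_le_of_lt (Seregin2020.blowupIndex_le_limsup_cknC 0 U G) (lt_of_le_of_lt ?_ hI')
    refine limsup_le_of_le (by isBoundedDefault) ?_
    filter_upwards [Ioo_mem_nhdsGT (zero_lt_one' ℝ)] with r hr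
    exact cknC_le_abScaledSum.trans (abScaledSum_le_typeIBound hr.1
      (SuitableCompactness.parabolicCylinder_zero_mono hr.1.le hr.2.le))
  -- ## (6) the zoom-in limit at the singular origin
  obtain ⟨K, κ, lam, w, ϖ, hκ, hlam, hlam0, hsingw, hlimw⟩ :=
    Seregin2020.exists_ancientLimit hsw3 hA3 hG3 hE3 hp3 hsing hI3
  have hball1 : IsSuitableWeakSolutionInBall 1 0 U P := hsw 1 one_pos
  have hG1 : HasWeakSpatialGradientOn
      (parabolicCylinderOpens 1 (0 : ℝ × EuclideanSpace ℝ (Fin 3))) U G := hG 1 one_pos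
  obtain ⟨hsww, H, hH, h4I⟩ := slab_typeIBound_of_zoomLimit
    (typeIBound (parabolicCylinder 1 (0 : ℝ × EuclideanSpace ℝ (Fin 3))) U P G) hI' one_pos
    hball1 hG1 le_rfl hlam hlam0
    (fun a ha => ⟨(hlimw a ha).1, (hlimw a ha).2.1, (hlimw a ha).2.2.1, (hlimw a ha).2.2.2.1⟩)
  -- ## (8) the rate, almost everywhere on the slab: the zooms obey it a.e., and a.e. bounds pass to `L³` limits
  set F : ℕ → ℝ → EuclideanSpace ℝ (Fin 3) → EuclideanSpace ℝ (Fin 3) :=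
    fun j => (lam j) • stPull ((lam j) ^ 2) (lam j) (0 : ℝ) (0 : EuclideanSpace ℝ (Fin 3)) U with hFdef
  have hFsuit : ∀ j (a : ℝ), 0 < a →
      IsSuitableWeakSolutionInBall a (0 : ℝ × EuclideanSpace ℝ (Fin 3)) (F j)
        ((lam j) ^ 2 • stPull ((lam j) ^ 2) (lam j) (0 : ℝ) (0 : EuclideanSpace ℝ (Fin 3)) P) := by
    intro j a ha
    have h := (hsw (a * lam j) (mul_pos ha (hlam j))).zoomOut (hlam j)
    rwa [mul_div_cancel_right₀ a (hlam j).ne'] at h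
  have hFm : ∀ j (a : ℝ), 0 < a → AEStronglyMeasurable (uncurry (F j))
      (volume.restrict (parabolicCylinder a (0 : ℝ × EuclideanSpace ℝ (Fin 3)))) := by
    intro j a ha
    have h := (hFsuit j a ha).1.distributional.1.aestronglyMeasurable
    rw [coe_parabolicCylinderOpens] at h
    exact h
  have hFrate : ∀ j (s : ℝ), s < 0 → ∀ᵐ y : EuclideanSpace ℝ (Fin 3), ‖F j s y‖ ≤ C / Real.sqrt (-s) := by
    intro j s hs
    have hμ := hlam j
    have hμ2 : 0 < lam j ^ 2 := pow_pos hμ 2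
    have hs2 : lam j ^ 2 * s < 0 := mul_neg_of_pos_of_neg hμ2 hs
    have h := (Measure.quasiMeasurePreserving_smul volume hμ.ne').ae (hrate (lam j ^ 2 * s) hs2)
    filter_upwards [h] with y hy
    have hsq : Real.sqrt (-(lam j ^ 2 * s)) = lam j * Real.sqrt (-s) := by
      rw [show -(lam j ^ 2 * s) = lam j ^ 2 * (-s) by ring, Real.sqrt_mul hμ2.le, Real.sqrt_sq hμ.le]
    have hpos : 0 < Real.sqrt (-s) := Real.sqrt_pos.2 (by linarith)
    have happ : F j s y = lam j • U (lam j ^ 2 * s) (lam j • y) := by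
      rw [hFdef]; simp only [Pi.smul_apply, stPull_apply, zero_add]
    rw [happ, norm_smul, Real.norm_eq_abs, abs_of_pos hμ]
    have hy' : ‖U (lam j ^ 2 * s) (lam j • y)‖ ≤ C / (lam j * Real.sqrt (-s)) := by rw [← hsq]; exact hy
    calc lam j * ‖U (lam j ^ 2 * s) (lam j • y)‖ ≤ lam j * (C / (lam j * Real.sqrt (-s))) :=
          mul_le_mul_of_nonneg_left hy' hμ.le
      _ = C / Real.sqrt (-s) := by field_simp
  have hae_rate : ∀ᵐ z ∂(volume.restrict (Iio (0 : ℝ) ×ˢ (univ : Set (EuclideanSpace ℝ (Fin 3))))),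
      ‖w z.1 z.2‖ ≤ C / Real.sqrt (-z.1) := by
    have hcover : Iio (0 : ℝ) ×ˢ (univ : Set (EuclideanSpace ℝ (Fin 3))) ⊆
        ⋃ n : ℕ, parabolicCylinder ((n : ℝ) + 1) (0 : ℝ × EuclideanSpace ℝ (Fin 3)) := by
      rintro ⟨s, y⟩ ⟨hs, -⟩
      obtain ⟨n, hn⟩ := exists_nat_ge (max (-s) ‖y‖)
      have h1 : -s ≤ n := (le_max_left _ _).trans hn
      have h2 : ‖y‖ ≤ n := (le_max_right _ _).trans hn
      have hs' : s < 0 := hs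
      refine mem_iUnion.2 ⟨n, ?_⟩
      rw [SuitableCompactness.mem_parabolicCylinder_zero]
      refine ⟨⟨?_, hs'⟩, by simp only; linarith⟩
      have h3 : (n : ℝ) + 1 ≤ ((n : ℝ) + 1) ^ 2 := by nlinarith [n.cast_nonneg (α := ℝ)]
      linarith
    refine ae_restrict_of_ae_restrict_of_subset hcover ?_
    rw [ae_restrict_iUnion_iff]
    intro n
    have hn : (0 : ℝ) < (n : ℝ) + 1 := by positivity
    refine ae_le_of_tendsto_eLpNorm_three (fun j => hFm j _ hn) (hlimw _ hn).2.1.aestronglyMeasurable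
      (hlimw _ hn).2.2.1 (Eventually.of_forall fun j => ?_)
    exact ae_cylinder_rate_of_slices (hFm j _ hn) (hFrate j)
  -- ## (9) a representative with the pointwise rate
  have h4top : typeIBound (Iio (0 : ℝ) ×ˢ univ) w ϖ H < ⊤ :=
    lt_of_le_of_lt h4I (ENNReal.mul_lt_top (by simp) hI')
  obtain ⟨w', haew, hsw', hwg', hIw', hdec', hsing''⟩ :=
    exists_rate_profile_repr hC hsww hH h4top hsingw hae_rate
  -- ## (10) the plain pressure bound at every apex `≤ 0`
  have hpm : AEStronglyMeasurable (uncurry P)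
      (volume.restrict (parabolicCylinder (1 / 2) (0 : ℝ × EuclideanSpace ℝ (Fin 3)))) :=
    (hsw (1 / 2) (by norm_num)).2.2.2.aestronglyMeasurable
  have hDlim : ∀ z : ℝ × EuclideanSpace ℝ (Fin 3), z.1 ≤ 0 → ∀ r : ℝ, 0 < r → cknD r z ϖ ≤ D₀ := by
    intro z hz r hr
    refine blowup_cknD_le_apex_of_tendsto (z₀ := (0 : ℝ × EuclideanSpace ℝ (Fin 3))) hpm
      (K := (D₀ : ℝ≥0∞)) (τ := 1) (r₁ := 1) (ρ := 1) one_pos one_pos one_pos ?_ hlam hlam0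
      (fun a ha => (hlimw a ha).1.2.2.2) (fun a ha => (hlimw a ha).2.2.2.1) hz hr
    intro z' hz' _ _ r' hr'
    exact hD z' (by simpa using hz') r' hr'.1
  -- ## (13) the weak top-vanishing of `w` (uniform pairing modulus)
  have hAhalf : ∀ r ∈ Ioc (0 : ℝ) (1 / 2), cknAEss r (0 : ℝ × EuclideanSpace ℝ (Fin 3)) U ≤ (max M D₀ : ℝ≥0) := by
    intro r hr
    refine le_trans ?_ (le_trans (hI r hr.1) (by exact_mod_cast le_max_left M D₀))
    exact (cknAEss_le_abScaledSum (p := P) (G := G)).trans (abScaledSum_le_typeIBound hr.1 subset_rfl)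
  have hDhalf : ∀ r ∈ Ioc (0 : ℝ) (1 / 2), cknD r (0 : ℝ × EuclideanSpace ℝ (Fin 3)) P ≤ (max M D₀ : ℝ≥0) := by
    intro r hr
    exact le_trans (hD 0 le_rfl r hr.1) (by exact_mod_cast le_max_right M D₀)
  have hF3 : ∀ a : ℝ, 0 < a → ∀ j, MemLp (uncurry (F j)) 3
      (volume.restrict (parabolicCylinder a (0 : ℝ × EuclideanSpace ℝ (Fin 3)))) := by
    intro a ha j
    refine ⟨hFm j a ha, ?_⟩
    have hC' : cknC a (0 : ℝ × EuclideanSpace ℝ (Fin 3)) (F j) ≤ M := by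
      have h := cknC_nsZoom (hlam j) ha (0 : ℝ) (0 : EuclideanSpace ℝ (Fin 3))
        (0 : ℝ × EuclideanSpace ℝ (Fin 3)) U
      rw [Seregin2020.stAffine_zero_zero_apply_zero] at h
      rw [hFdef, h]
      exact (cknC_le_abScaledSum (p := P) (G := G)).trans
        ((abScaledSum_le_typeIBound (mul_pos (hlam j) ha) subset_rfl).trans (hI _ (mul_pos (hlam j) ha)))
    unfold cknC at hC'
    have ha2 : (ENNReal.ofReal a ^ 2)⁻¹ ≠ 0 := ENNReal.inv_ne_zero.2 (ENNReal.pow_ne_top ENNReal.ofReal_ne_top)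
    have hfin : ∫⁻ w' in parabolicCylinder a (0 : ℝ × EuclideanSpace ℝ (Fin 3)),
        ‖(F j) w'.1 w'.2‖ₑ ^ (3 : ℕ) < ⊤ := by
      have h1 : (ENNReal.ofReal a ^ 2)⁻¹ * ∫⁻ w' in parabolicCylinder a (0 : ℝ × EuclideanSpace ℝ (Fin 3)),
          ‖(F j) w'.1 w'.2‖ₑ ^ (3 : ℕ) < ⊤ := lt_of_le_of_lt hC' ENNReal.coe_lt_top
      by_contra htop'
      rw [not_lt, top_le_iff] at htop'
      rw [htop', ENNReal.mul_top ha2] at h1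
      exact lt_irrefl _ h1
    rw [eLpNorm_eq_lintegral_rpow_enorm_toReal (by norm_num) (by norm_num), ENNReal.toReal_ofNat]
    refine ENNReal.rpow_lt_top_of_nonneg (by norm_num) (ne_of_lt (lt_of_le_of_lt (le_of_eq ?_) hfin))
    refine lintegral_congr fun q => ?_
    show ‖F j q.1 q.2‖ₑ ^ (3 : ℝ) = ‖F j q.1 q.2‖ₑ ^ (3 : ℕ)
    rw [← ENNReal.rpow_natCast]
    norm_num
  have htop_w := weakNull_of_zoomLimit hsw hAhalf hDhalf htop hlam hlam0 hF3
    (fun a ha => (hlimw a ha).2.1) (fun a ha => (hlimw a ha).2.2.1)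
  -- ## (14) transfer to the representative `w'` and assemble
  have hQslab : ∀ a : ℝ, parabolicCylinder a (0 : ℝ × EuclideanSpace ℝ (Fin 3)) ⊆
      Iio (0 : ℝ) ×ˢ (univ : Set (EuclideanSpace ℝ (Fin 3))) := fun a => parabolicCylinder_origin_subset_slab a
  have hQle : ∀ a : ℝ, parabolicCylinderOpens a (0 : ℝ × EuclideanSpace ℝ (Fin 3)) ≤
      slab (EuclideanSpace ℝ (Fin 3)) (Iio 0) isOpen_Iio := by
    intro a z hz
    show z ∈ ((slab (EuclideanSpace ℝ (Fin 3)) (Iio 0) isOpen_Iio : Opens (ℝ × EuclideanSpace ℝ (Fin 3))) :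
      Set (ℝ × EuclideanSpace ℝ (Fin 3)))
    rw [coe_slab]
    exact hQslab a hz
  set M' : ℝ≥0 := (typeIBound (Iio (0 : ℝ) ×ˢ univ) w' ϖ H).toNNReal with hM'
  have hM'eq : ((M' : ℝ≥0) : ℝ≥0∞) = typeIBound (Iio (0 : ℝ) ×ˢ univ) w' ϖ H := ENNReal.coe_toNNReal hIw'.ne
  have hslice : ∀ᵐ s ∂(volume.restrict (Iio (0 : ℝ))), ∀ᵐ y : EuclideanSpace ℝ (Fin 3), w s y = w' s y := by
    have h1 : ∀ᵐ z ∂((volume.restrict (Iio (0 : ℝ))).prod (volume : Measure (EuclideanSpace ℝ (Fin 3)))),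
        uncurry w z = uncurry w' z := by
      rw [← Measure.restrict_univ (μ := (volume : Measure (EuclideanSpace ℝ (Fin 3)))),
        Measure.prod_restrict, ← Measure.volume_eq_prod]
      exact haew
    exact Measure.ae_ae_of_ae_prod h1
  have haew_a : ∀ a : ℝ, ∀ᵐ z ∂(volume.restrict (parabolicCylinder a (0 : ℝ × EuclideanSpace ℝ (Fin 3)))),
      uncurry w z = uncurry w' z := fun a => ae_restrict_of_ae_restrict_of_subset (hQslab a) haew
  refine ⟨lam, M', D₀, C, w', ϖ, H, hlam, hlam0, ?_, ?_, ?_, hDlim, ?_, ?_, ?_, ?_⟩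
  · intro a ha
    exact (hlimw a ha).1.congr_ae' (haew_a a) (ae_of_all _ fun _ => rfl)
  · intro a _
    exact hwg'.mono (hQle a)
  · intro a _
    rw [hM'eq]
    exact typeIBound_mono (hQslab a)
  · intro s hs
    exact ae_of_all _ fun y => hdec' s hs y
  · intro φ hφ hφc ε hε
    obtain ⟨s₀, hs₀, hw⟩ := htop_w φ hφ hφc ε hε
    refine ⟨s₀, hs₀, ?_⟩
    have hsl_r : ∀ᵐ s ∂(volume.restrict (Ioo s₀ 0)),
        ∀ᵐ y : EuclideanSpace ℝ (Fin 3), w s y = w' s y :=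
      ae_restrict_of_ae_restrict_of_subset Ioo_subset_Iio_self hslice
    filter_upwards [hw, hsl_r] with s hs hsl
    have e : ∫ y, ⟪w' s y, φ y⟫ = ∫ y, ⟪w s y, φ y⟫ :=
      integral_congr_ae (hsl.mono fun y hy => by simp only [hy])
    rw [e]
    exact hs
  · intro a ha
    have hmem : MemLp (uncurry w') 3
        (volume.restrict (parabolicCylinder a (0 : ℝ × EuclideanSpace ℝ (Fin 3)))) :=
      (hlimw a ha).2.1.ae_eq (haew_a a)
    refine ⟨hmem, ?_⟩
    refine ((hlimw a ha).2.2.1).congr fun j => ?_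
    refine eLpNorm_congr_ae ?_
    filter_upwards [haew_a a] with z hz
    simp only [Pi.sub_apply, hz]
  · -- non-triviality: the floor `κ ≤ C(1; w) = C(1; w')`
    intro hzero
    have hfl := (hlimw 1 one_pos).2.2.2.2.2.2.2
    have hC0 : cknC 1 (0 : ℝ × EuclideanSpace ℝ (Fin 3)) w = 0 := by
      unfold cknC
      rw [lintegral_congr_ae ((haew_a 1).mono fun z hz => by
        show ‖w z.1 z.2‖ₑ ^ (3 : ℕ) = ‖w' z.1 z.2‖ₑ ^ (3 : ℕ)
        have : uncurry w z = uncurry w' z := hz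
        simp only [uncurry] at this
        rw [this])]
      rw [lintegral_congr_ae (hzero.mono fun z hz => by
        show ‖w' z.1 z.2‖ₑ ^ (3 : ℕ) = (0 : ℝ≥0∞)
        rw [hz]; simp)]
      simp
    rw [hC0] at hfl
    have : ENNReal.ofReal κ = 0 := le_antisymm hfl bot_le
    exact absurd (ENNReal.ofReal_eq_zero.1 this) (not_le.2 hκ)

end Summit.NavierStokesRegularity.NavierStokesRegularity.Theorems.TypeITraceScarL3

end
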